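import Summits.QuantumFields.YangMills.Theorems.FlatTubeReductionDecimationChainDefs
import Summits.QuantumFields.YangMills.Theorems.FlatTubeReductionDecimationShear
import HarnessLib

/-!
# Route `FlatTubeReduction`, crux `PinnedUnitStepEx` (stmt-QuantumFields-27561), stub `stub_smearVarPosGS1` — PP-b: partial products along a chain

Seat ym-line-fcl-p3 g9 (2026-08-28).  Lemmas for `chainProd` (`…DecimationChainDefs`): unfolding, `chainProd_apply_of_notMem_tail` (coordinates off the
tail of the chain are untouched), ★ `chainProd_apply_getElem` (on a duplicate-free chain the `i`-th coordinate becomes the partial product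
`x_{c₀} ⋯ x_{c_i}`), ★ `measurePreserving_chainProd` (composite of the measure-preserving shears of `…DecimationShear`).  After blueprint v2's
simplification (one-site gauge transformations) this change of variables is no longer on the critical path of stub 1; it is landed as a reusable
generality (partial products of independent Haar variables are independent Haar).  R2b1 RECORD rung; no summit/crux/stub here.
-/

set_option autoImplicit false

noncomputable section

namespace Summit.QuantumFields.YangMills.Theorems.FlatTubeReduction.Decimation

open MeasureTheory Finset Function
open Literature.MathematicalPhysics.QuantumFieldTheory (haarProbability)

section Algebra

variable {ι : Type*} [DecidableEq ι] {G : Type*} [Mul G]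

/-- Unfolding, empty chain. [folklore] -/
@[simp] theorem chainProd_nil (x : ι → G) : chainProd ([] : List ι) x = x := rfl

/-- Unfolding, one-point chain. [folklore] -/
@[simp] theorem chainProd_singleton (a : ι) (x : ι → G) : chainProd [a] x = x := rfl

/-- Unfolding, recursion step. [folklore] -/
theorem chainProd_cons_cons (a b : ι) (t : List ι) (x : ι → G) :
    chainProd (a :: b :: t) x = chainProd (b :: t) (Function.update x b (x a * x b)) := rfl

/-- **Off the tail of the chain nothing changes** (the head and every coordinate outside the chain keep their value). [folklore] -/
theorem chainProd_apply_of_notMem_tail : ∀ (l : List ι) (x : ι → G) (e : ι), e ∉ l.tail → chainProd l x e = x e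
  | [], x, e, _ => rfl
  | [a], x, e, _ => rfl
  | a :: b :: t, x, e, he => by
    rw [chainProd_cons_cons]
    have hb : e ≠ b := fun h => he (by simp [h])
    have he' : e ∉ (b :: t).tail := fun h => he (by simp only [List.tail_cons] at h ⊢; exact List.mem_cons_of_mem b h)
    rw [chainProd_apply_of_notMem_tail (b :: t) _ e he', Function.update_of_ne hb]

/-- **On the chain: partial products.**  For a duplicate-free chain `l` and `i < l.length`,
`chainProd l x (l[i]) = x_{l[0]} ⋯ x_{l[i]}` (`= (l.take (i+1)).map x` multiplied left to right). [folklore] -/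
theorem chainProd_apply_getElem {G : Type*} [Monoid G] :
    ∀ (l : List ι) (_ : l.Nodup) (x : ι → G) (i : ℕ) (hi : i < l.length),
      chainProd l x (l[i]) = ((l.take (i + 1)).map x).prod
  | [], _, x, i, hi => absurd hi (Nat.not_lt_zero i)
  | [a], _, x, i, hi => by
    have hi0 : i = 0 := by simpa using hi
    subst hi0
    simp [chainProd]
  | a :: b :: t, hnd, x, i, hi => by
    rw [chainProd_cons_cons]
    have hab : a ≠ b := by
      intro h; subst h; simp at hnd
    have hat : a ∉ t := fun h => by simp [h] at hnd
    have hnd' : (b :: t).Nodup := (List.nodup_cons.1 hnd).2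
    rcases i with _ | i
    · -- the head is untouched
      simp only [List.getElem_cons_zero, List.take_succ_cons, List.take_zero, List.map_cons, List.map_nil, List.prod_cons,
        List.prod_nil, mul_one]
      rw [chainProd_apply_of_notMem_tail]
      · exact Function.update_of_ne hab _ _
      · simpa using hat
    · have hi' : i < (b :: t).length := by simpa using hi
      have ih := chainProd_apply_getElem (b :: t) hnd' (Function.update x b (x a * x b)) i hi'
      simp only [List.getElem_cons_succ] at ih ⊢
      rw [ih]
      -- compare the two partial products: the updated configuration differs from `x` only at `b = (b :: t)[0]`
      rw [List.take_succ_cons, List.map_cons, List.prod_cons, List.take_succ_cons, List.map_cons, List.prod_cons]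
      have hbt : b ∉ t := fun h => by simp [h] at hnd'
      rw [Function.update_self, mul_assoc]
      congr 2
      refine congrArg List.prod (List.map_congr_left fun e he => ?_)
      have : e ∈ t := List.mem_of_mem_take he
      exact Function.update_of_ne (fun h : e = b => hbt (h ▸ this)) _ _

end Algebra

section Measure

variable {ι : Type*} [Fintype ι] [DecidableEq ι]
variable {G : Type*} [Group G] [TopologicalSpace G] [IsTopologicalGroup G] [CompactSpace G] [MeasurableSpace G] [BorelSpace G]
  [SecondCountableTopology G]

/-- ★ **Partial products preserve the product Haar measure** (duplicate-free chain): composite of measure-preserving shears. [folklore] -/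
theorem measurePreserving_chainProd : ∀ (l : List ι), l.Nodup →
    MeasurePreserving (chainProd l : (ι → G) → (ι → G)) (Measure.pi fun _ : ι => haarProbability G) (Measure.pi fun _ : ι => haarProbability G)
  | [], _ => by
    rw [show (chainProd ([] : List ι) : (ι → G) → ι → G) = id from funext fun x => rfl]
    exact MeasurePreserving.id _
  | [a], _ => by
    rw [show (chainProd [a] : (ι → G) → ι → G) = id from funext fun x => rfl]
    exact MeasurePreserving.id _
  | a :: b :: t, hnd => by
    have hab : a ≠ b := by intro h; subst h; simp at hnd
    have hnd' : (b :: t).Nodup := (List.nodup_cons.1 hnd).2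
    have h := (measurePreserving_chainProd (b :: t) hnd').comp (measurePreserving_update_mul_left (G := G) (ι := ι) hab)
    exact h

end Measure

end Summit.QuantumFields.YangMills.Theorems.FlatTubeReduction.Decimation
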